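import Mathlib
import HarnessLib
import HarnessLib.Audit
import Summits.AtomisticToContinuum.Statement
import Literature.MathematicalPhysics.QuantumManyBody.PeriodicBoseGas
import Literature.Barriers.AtomisticToContinuum.OneDimensionalHardCore

/-!
Route: BECLevyCoherence

CLOSED (retired) 2026-08-15T13:39:16Z by operator:999:1257524 — reason: not-a-thesis: assembly does not conclude the sub-problem Statement — note: D-0027 §2.1 audit (human 2026-08-15: routes that do not decide the summit are removed): the assembly concludes `Literature.MathematicalPhysics.QuantumManyBody.BoseGas.BoseEinsteinCondensation`, not the sub-problem statement; a NEW conforming route may be opened from the same idea (generated `closes . The file is kept as the record of this route; refuted decls are indexed as negative knowledge (`ledger negatives`).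

# Route BECLevyCoherence — coherence is infinitely divisible — torus BEC as a finite Lévy mass of
log γ (negative type of −log γ on an infrared grid + a negative-moment infrared bound), false in d=1
by (π−4)²>0

It suffices to show X = GridInfDivCoherence ∧ LevyNegativeMoment (card
levy-coherence-strings-vs-clouds, items K1 = (ID) in its
infrared form and the negative-moment bound of its M4), together with the shared boundary-condition
transfer BoundaryTransferWeak of
route BECPeriodicReduction (stmt-0827). Setting: δ-near-minimisers Ψ of the PERIODIC N-body energy
on the torus of side L = (N/ρ)^(1/3),
their translation coherence G_Ψ(r) = Re ∫ conj Ψ(…, x_i + r, …) Ψ dX (= γ̄(r)/ρ, G(0) = 1), sampled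
on the grid (L/m)ℤ³, m = ⌊L/η⌋,
and the DISCRETE LÉVY WEIGHTS ν̃_q = m⁻³ Σ_j log G(r_j) cos(2π q·j/m), q ∈ (ℤ/m)³ ∖ 0.
GridInfDivCoherence (INFRARED INFINITE DIVISIBILITY): for every repulsive finite-range v there is a
UV scale η > 0 and ρ₀ > 0 such that
for 0 < ρ < ρ₀, all large N, every ε > 0, some δ > 0: every δ-near-minimiser has G_Ψ > 0 and ν̃_q ≥
−ε for all q ≢ 0 — i.e. on the
η-grid −log G_Ψ is conditionally negative definite (Schoenberg), G_Ψ restricted to the grid is an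
infinitely divisible kernel.
LevyNegativeMoment (LOG-LEVEL INFRARED BOUND): for every η > 0 there are C and ρ₀ > 0 with Σ_(q≠0)
max(ν̃_q, 0)/|k_q| ≤ C
(|k_q| = (2π/L)‖q̄‖) for near-minimisers, uniformly in N — the Lévy measure of the coherence has a
bounded (−1)-moment.
Lean: `GridInfDivCoherence ∧ LevyNegativeMoment ∧ BoundaryTransferWeak`

## Assembly
Pure logic (theorem assembly_holds in Sketch.lean, term `fun h1 h2 h3 h4 h5 h6 v hv => h6 v hv (h5
h1 h2 h3 h4 v hv)`): the glue
LevyMassCondensation turns the two cruxes (with the two provable-now supports) into PeriodicBEC —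
constant-mode condensation for
near-minimisers on the torus, the signature of BECPeriodicReduction.PeriodicBEC — and
BoundaryTransferWeak carries it to the Dirichlet,
mode-free conjunct. TonksPairNotInfDiv is the negative-side delimiter and is not used in the
assembly.

Rationale: WHY THIS LINE. Mechanism (card levy-coherence-strings-vs-clouds): if −log G is of negative type
then, by Lévy–Khintchine on the finite torus grid,
−log G(r) = Σ_q ν̃_q (1 − cos k_q·r) with ν̃ ≥ 0, the grid geometric mean of G is exp(−Σ ν̃_q), and
the condensate fraction is a
zero-phonon (Debye–Waller) weight f₀ ≳ e^(−|ν̃|): BEC ⟺ finite Lévy mass. The Lévy mass is then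
bounded by TWO MOMENTS of a positive
measure — the second moment is the kinetic energy per particle (discrete f-sum Σ ν̃_q λ_q = Δ_h(−log
G)(0) ≤ 2τ, τ ≤ E₀/N ≤ 4πρa(1+Ca/b)
by the PROVED fact LSSY2005_upperBound_periodic_holds) and the (−1)-moment is the crux
LevyNegativeMoment — via Hölder
|ν̃| ≤ (Σν̃|k|²)^(1/3)(Σν̃/|k|)^(2/3); every estimate is multiplicative, so no smallness of
constants is ever needed (an occupation-level
argument must certify Σ_(k≠0) n_k ≤ (1−c)N). Imported area: harmonic analysis on semigroups /
infinitely divisible kernels (Schoenberg1938;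
BergChristensenRessel1984 Ch. 3 Thm 2.2, Prop 2.7; BergForst1975) pointed at the one-body density
matrix, whose Gaussian (Bogoliubov) level
is exactly of this form (MoraCastin2003 §4.3: ln g₁/ρ = g₁^Bog/ρ − 1 to order ε²;
GavoretNozieres1964, Griffin1993 §4.1 for n_k ~ n₀mc/2|k|).
What is new relative to the 35 open routes of this conjunct (none uses negative type, Hadamard
powers or log γ; negatives index empty): the
SIGN of the transform of log γ as the structural hypothesis, a d = 1 counterexample typed on
girardeauDensityMatrix (TonksPairNotInfDiv), and a
grid (UV-safe, finite-Fourier) formulation matching the card's 38-instance exact-diagonalisation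
census.

RANKED CRUXES. #2 GridInfDivCoherence (crux) — (card K1, infrared form) for every repulsive
finite-range v there are η > 0 and ρ₀ > 0 such that for 0 < ρ < ρ₀, for all large N, for every ε > 0
there is δ > 0 with: every δ-near-minimiser Ψ of the periodic energy on the torus of side L =
(N/ρ)^(1/3) has strictly positive translation coherence G_Ψ(i,·) and, on the grid of m = ⌊L/η⌋
points per side, all discrete Lévy weights ν̃_q = m⁻³ Σ_j log G_Ψ(i, (L/m)j) cos(2π q·j/m), q ≢ 0
mod m, are ≥ −ε (−log G_Ψ is conditionally negative definite on the grid; rank 2: line-defining and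
cheaply falsifiable). [difficulty: open-problem] (why it might fail: The sign is not automatic: UV
zeros of the pair amplitude give negative continuum weights at |k|~π/a (N=2: mass fraction 1e-6 at
L/R=10) which grid sampling folds onto infrared classes; an infrared failure needs string-like order
(d=1: one negative weight at 2k_F) — unproven absent in a 3D fluid.) [MoraCastin2003,
Schoenberg1938, BergChristensenRessel1984, PenroseOnsager1956, ForresterEtAl2003]
#3 LevyNegativeMoment (crux) — (card M4, the quantity LOGCLUSTER was designed to bound) for every
repulsive finite-range v and every grid scale η > 0 there are C and ρ₀ > 0 such that for 0 < ρ < ρ₀,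
for all large N, some δ > 0: every δ-near-minimiser satisfies Σ_(q≢0) max(ν̃_q,0)/|k_q| ≤ C with
|k_q| = (2π/L)·(centred norm of q) — the positive part of the grid Lévy measure has an N-uniform
(−1)-moment (Bogoliubov value ≈ √2·a/π, density-independent; C may depend on v and η but not on ρ,
N). [difficulty: open-problem] (why it might fail: A log-level infrared bound (Lévy weights summable
against 1/|k| uniformly in N and in ρ→0): any expansion proof meets BogoliubovPerturbationInfrared
at d=3, and beyond one-jump dominance ν_k≈n_k/n₀ nothing non-perturbative controls ν; ρ-uniformity
of C is an extra bet.) [GavoretNozieres1964, Griffin1993, MoraCastin2003,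
LiebSeiringerSolovejYngvason2005, Fournais2020]
#4 BoundaryTransferWeak (crux) — (shared with BECPeriodicReduction, stmt-0827, verbatim) for each
repulsive finite-range v, constant-mode condensation for near-minimisers of the periodic problem at
all small densities implies the conjunct's Dirichlet, mode-free criterion HasGroundStateBEC v ρ for
all small ρ. [difficulty: L] (why it might fail: PeriodicBEC(v) is ground-state-only (δ after N):
the Dirichlet ground state lies a wall term ≫ δ above E₀^per and interior restrictions are neither
periodic nor of sharp N, so the hypothesis may never fire; BEC is boundary-condition sensitive
(Robinson1976).) [LiebSeiringerSolovejYngvason2005, BoccatoSeiringer2023, Junge2026, Robinson1976,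
LauwersVerbeureZagrebnov2003]
#9 GridAverageCondensate (support) — (aliasing / Poincaré on cells, provable now) for L > 0, m ≥ 1,
T ≥ 0, any periodic trial state Ψ with total kinetic energy ≤ T and any particle i:
condensateOccupation N L Ψ ≥ N·(grid average of G_Ψ(i,·) over the m³ nodes (L/m)j) − T(L/m)²/(4π²).
Proof: grid average = Σ_(k∈(2πm/L)ℤ³) g_k with g_k = n_k/N ≥ 0 (Fourier in particle i), g_0 = n₀/N
by the definition of condensateOccupation, and Σ_(|k|≥2πm/L) g_k ≤ (L/2πm)² Σ |k|² g_k =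
(L/2πm)²·(∫|∇_iΨ|²) = (L/2πm)² T/N by Bose symmetry. [difficulty: provable-now] [Fournais2020,
LiebSeiringerSolovejYngvason2005]
#9 ScatteringLengthFinite (support) — (shared with BECPinning / EqualScatteringTransfer, stmt-0851)
finite range R₀ ⇒ scatteringLength v ≠ ⊤ (trial φ ∈ C¹, φ = 0 on B_R₀, φ = 1 off B_(R₀+1), so v·φ² =
0 including hard cores since ⊤·0 = 0; scatteringLength_le). Needed by the glue to invoke
LSSY2005_upperBound_periodic_holds. [difficulty: provable-now] [LiebSeiringerSolovejYngvason2005]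
#9 LevyMassCondensation (support) — (glue, card M3–M4; conclusion = BECPeriodicReduction.PeriodicBEC
= stmt-0826 body verbatim, so closing it closes 0826 by a one-line theorem) GridInfDivCoherence →
LevyNegativeMoment → ScatteringLengthFinite → GridAverageCondensate → constant-mode BEC for
near-minimisers on the torus at all small densities. Proof (finite-dimensional but for two inputs):
fix v, take η, ρ₀ from GridInfDiv and C from LevyNegativeMoment at that η; for N large h := L/m ∈
[η, 2η), τ := (E₀^per+δ)/N ≤ τ* := 8πρa + 1 (LSSY2005_upperBound_periodic_holds +
ScatteringLengthFinite); (i) G > 0 on the grid, F := log G∘nodes is real, even on (ℤ/m)³, so F(j) =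
Σ_q ν̃_q cos(2πq·j/m) and −F(j) = Σ_(q≠0) ν̃_q(1 − cos) (F(0)=0); (ii) discrete f-sum: Σ_q ν̃_q λ_q
= −(2/h²)Σ_a F(e_a) ≤ 2τ since 1 − G(he_a) ≤ τ_a h²/2 (‖T_rΨ−Ψ‖ ≤ |r|‖∂_rΨ‖) and −log x ≤ 2(1−x) on
[1/2,1], where λ_q = (2/h²)Σ_a(1−cos(2πq̄_a/m)) ≥ (4/π²)|k_q|²; with ν̃ ≥ −ε and ε := h²/(12m³): Σ
ν̃⁺|k_q|² ≤ (π²/4)(2τ*+1); (iii) Hölder(3,3/2): Λ := Σ_(q≠0) ν̃_q ≤ Σ ν̃⁺ ≤ ((π²/4)(2τ*+1))^(1/3)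
C^(2/3) =: Λ*; (iv) AM–GM over the m³ grid values: grid average of G ≥ exp(mean F) = e^(−Λ) ≥
e^(−Λ*); (v) GridAverageCondensate: n₀/N ≥ e^(−Λ*) − τ*(2η)²/(4π²) ≥ e^(−Λ*)/2 =: c once ρ is small
(τ* → 1 is harmless: choose ε smaller, or note τ*η² ≤ (8πρa+δ/N)·η² with δ ≤ 1). [difficulty: M]
[BergChristensenRessel1984, LiebSeiringerSolovejYngvason2005, Fournais2020]
#9 TonksPairNotInfDiv (support) — (card T1/P2, the d = 1 delimiter, provable now, no hypotheses) for
two impenetrable bosons on a ring of circumference L > 0 the Girardeau one-body density matrix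
violates negative type of −log γ with charges (+,−,+,−) at 0, L/4, L/2, 3L/4: γ₂(0,0)·γ₂(L/2,0) <
γ₂(L/4,0)². Closed form γ₂(x,0) = (2/L)[(1−2r)cos πr + (2/π) sin πr], r = |x|/L (integrate
|sin||sin|), so the claim is (2/π)·1 < 2(1/4+1/π)² ⟺ 16π < (π+4)² ⟺ (π−4)² > 0; numerically 2.5465 <
2.5838 at L = 1. Finish with nlinarith [Real.pi_gt_three, Real.pi_lt_four] after the two
one-dimensional integrals. [difficulty: provable-now] [ForresterEtAl2003, Girardeau1960, Lenard1964,
Schoenberg1938]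

TWO-LAYER PLAN. Foreseen glued splits (k ≤ 3, depth 1), none filed now: LevyNegativeMoment ⇐
LogCluster (card K2: |log G(r) − ⟨log G⟩| ≤ A(r/ξ)^(−1−ε′)
for r ≥ Mξ, uniformly in L) → ShortRangeLevyMass (the r < Mξ part, ≤ (2/π)Mξ|ν̃| which the bootstrap
absorbs) → LevyNegativeMoment
(card M4: M_(−1) = V⁻¹∫ C_ν K_1, K_1 ≈ 1/2π²r²). GridInfDivCoherence ⇐ PerturbativeWindow (ν̃ ≥ 0
wherever the renormalised Bogoliubov
expansion is summable, MoraCastin2003 order ε²) → InfraredExtension (one-jump dominance ν_k ≃ n_k/n₀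
as k → 0) → GridInfDivCoherence.
BoundaryTransferWeak: as planned in BECPeriodicReduction (Neumann bracketing + mode-free criterion
λ_max ≥ tr γ²/N).

KILL CRITERIA. One negative infrared discrete Lévy weight (ν̃_q < 0, |k_q| ≲ 1/ξ, robust as L grows)
in ANY d ≥ 2 many-body repulsive Bose ground state —
lattice ED/DMRG on 6×6, 8×8 tori to half filling or worm/PIGS QMC for 3D hard or soft spheres at ρa³
= 10⁻⁴…10⁻², N = 64…512 — refutes
GridInfDivCoherence and closes the route `refuted:GridInfDivCoherence` (TonksPairNotInfDiv and the
census then stand as negative knowledge on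
harmonic-fluid exactness). A proof that Σν̃⁺/|k| grows with N for some admissible v refutes
LevyNegativeMoment only: pivot to the LogCluster
split or to p-moments Σν̃⁺/|k|^p, 0 < p < 2 (Hölder works for any p < 2). PeriodicBEC (stmt-0826)
proved by any other route moots both cruxes;
¬BoundaryTransferWeak breaks every torus route at once.

NOT DECOMPOSED YET. The discrete Lévy–Khintchine / Hölder / AM–GM bookkeeping inside
LevyMassCondensation (prover helper lemmas, `--supports`); the constants
(π²/4, factor 2 in the f-sum, ε := h²/12m³); positivity G_Ψ > 0 for near-minimisers (folded into
GridInfDivCoherence, where it belongs: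
infinite divisibility is a property of positive kernels); the GP-scale corollary of
GridInfDivCoherence ALONE (card M5: |ν̃| ≤ τL²/8, hence
n₀/N ≥ e^(−τL²/8) − τh²/4π², i.e. BEC with constant e^(−g/π)-type on boxes ρaL² = g from the energy
upper bound alone) — not expressible along
L = (N/ρ)^(1/3) and left as a prover's remark; the compound-Poisson / n₀-free Gavoret–Nozières
dictionary (card M3), which motivates but is
not load-bearing; any regime split soft vs hard-core v.

CHEAPEST FALSIFIER. Exact diagonalisation the refuter can rerun (triage-16 has ed_pure.py):
hard-core bosons on 6×6 and 8×8 tori at fillings 0.1–0.3 (the card's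
advice: aim at |k| ~ 1/ξ, moderate filling, large tori, not (π,π) at half filling) — one robust
negative nonzero-k weight of log γ kills
GridInfDivCoherence. Run so far (card + triage-16, independently): 38 + 30 instances in d = 2, 3 and
ladders, 0 negative weights, Hadamard
powers to t = 0.02 PSD, f₀/e^(−|ν|) ∈ [1.000, 1.021]; d = 1 hard-core rings: exactly one negative
weight at q = N. Second cheapest: N = 2 hard
spheres on a 3D torus (two-body problem, exact): fold the continuum weights onto grids m = 4…16 and
check the sign of the folded sums
(tests the UV-aliasing failure mode of the grid form directly). I could not run either here (hub is
compute-free; no numpy); the toy check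
I did run (Bogoliubov occupations on 24³ tori, grids m = 6…12, pure python) gives all ν̃ > 0, e^(−Λ)
= f₀ to 4 digits, the discrete f-sum
identity exact, Hölder slack 20–40 %, M_(−1) ≈ 0.21–0.39 ≈ O(a) flat in ρ.

NUMBERS. Bogoliubov values the cruxes are measured against (ħ = 2m = 1, ξ = (8πρa)^(−1/2), τξ² =
1/2): ν_k ≈ n_k/N ≈ 1/(2√2 N|k|ξ) for |k|ξ ≪ 1;
|ν| ≈ depletion ≈ 1.5(ρa³)^(1/2)-order; M_(−1) = Σν_k/|k| → c₀a/π² (density-independent; toy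
0.21–0.39 for a = 1); f-sum Σν_k|k|² = τ ≤
4πρ₁a(1 + 12a/b) (LSSY2005_upperBound_periodic_holds, C = 12). d = 1 witness:
γ₂(L/4)²/(γ₂(0)γ₂(L/2)) = (π+4)²/16π = 1.01466; ν₂ =
−1.8634·10⁻³ (N = 2), ν₃ = −1.49·10⁻³ (N = 3), L·ν_(2k_F) → −0.0122 at lattice filling 1/4. Census
minima in d ≥ 2: ν_min = 6.6·10⁻⁴…1.5·10⁻²
(4×4), 4.1·10⁻⁵…1.3·10⁻⁴ (4×4×4). Items at open: 8 (3 cruxes, 4 support, 1 assembly).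

DEFINITION REQUESTS. None needed to type the items (everything is inlined over
Literature.MathematicalPhysics.QuantumManyBody.BoseGas.{PeriodicTrialState,
periodicEnergy, periodicGroundStateEnergy, sideLength, cellN, latticeVec, kineticDensity,
condensateOccupation, scatteringLength,
IsRepulsiveFiniteRange, HasGroundStateBEC, BoseEinsteinCondensation} and
Literature.Barriers.AtomisticToContinuum.BoseGas.girardeauDensityMatrix,
all `lean search`-verified; Sketch.lean rc 0). Nice-to-have later (not filed): `torusCoherence N L Ψ
i r` and `gridLevyWeight` abbreviations
under Summits/AtomisticToContinuum/BoseEinsteinCondensation/Theorems to shorten the signatures.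

Novelty: Searches (2026-08-15): `lit galaxy search --star all` ×5 — "infinitely divisible kernel" (12 rows:
ML/RKHS, Donoghue, and BCR GTM 100 =
panama:508704516472908), "Hadamard power density matrix" (0), "compound Poisson momentum
distribution" (0), "negative definite kernel Bose" (0),
"Levy-Khintchine Bose gas" (0); `lit search --hybrid --source local` "negative definite functions
Lévy-Khintchine compact abelian group
Schoenberg" (8 books: book:berg1984-harmonic-analysis-semigroups pp. 74–86, Heyer 1984, Applebaum
2014 — pure harmonic analysis, no Bose gas);
`lit frontier AtomisticToContinuum --since 2021` (30 rows; condensation entries arXiv:2510.20493,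
arXiv:2603.20776 are occupation-level
localisation, nothing on log γ); `lit bridges AtomisticToContinuum --cross any` (no relevant
bridge); remote `lit search` (searchd) was
unavailable twice (rc 75) — the card's refuter audit of today (triage-16: S2/OpenAlex/arXiv/zbMATH
×6/Crossref, 115 cards grepped) found
nothing on infinite divisibility / negative type of γ or n_k either; grep of all 35 Theses of the
conjunct for levy|negative type|infinitely
divisib|Schoenberg|Hadamard: 0.
Nearest prior art found: MoraCastin2003 (arXiv:cond-mat/0212523 §4.3: ln[g₁/ρ] = g₁^Bog/ρ − 1, the
Lévy–Khintchine form exact to order ε²);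
harmonic-fluid g₁ = ρe^(−Var/2) (Haldane 1981, Popov); Schoenberg1938 and BergChristensenRessel1984
Ch. 3 Thm 2.2 / Prop 2.7 (negative type ⟺
infinitely divisible kernel); in-programme: the occupation-level torus route  [refs: 2510.20493, 2603.20776, cond-mat/0212523, book:berg1984-harmonic-analysis-semigroups, MoraCastin2003, Schoenberg1938, BergChristensenRessel1984]

Barriers (technique_class: Schoenberg-negative-type, Levy-Khintchine, log-coherence): - technique_class: Schoenberg-negative-type, Levy-Khintchine, log-coherence
- Literature.Barriers.AtomisticToContinuum.OneDimensionalHardCore: evaded head-on — the structural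
hypothesis is FALSE for the impenetrable 1D gas (TonksPairNotInfDiv: one negative weight at 2k_F;
(π−4)² > 0 for N = 2), so no step of the line applies verbatim in d = 1; all positive claims are d =
3 statements about near-minimisers.
- Literature.Barriers.AtomisticToContinuum.PitaevskiiStringariOneDimension: same evasion; moreover
given (ID) BEC ⟺ finite Lévy mass, and with ν ≍ 1/|k| the mass ∫d^dk ν is finite iff d ≥ 2 at T = 0
— the barrier is "infinite Lévy activity", which LevyNegativeMoment excludes only in d = 3.
- Literature.Barriers.AtomisticToContinuum.HohenbergLowDimension: T = 0 only; the thermal law ν ≍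
T/|k|² would need d ≥ 3 and is not claimed.
- Literature.Barriers.AtomisticToContinuum.BogoliubovPerturbationInfrared: it does not, for
LevyNegativeMoment, if that crux is attacked by expansion (d = 3 marginal); the bet is that a
SIGN-protected, cumulant-level quantity (Lévy masses add under approximate independence where
occupations convolve) admits a non-perturbative monotonicity/response proof; GridInfDivCoherence is
exact where the series is finite (order ε²) and is tested non-perturbatively by the census.
- Literature.Barriers.AtomisticToContinuum.KineticGapLengthScales: the f-sum enters only as the
second moment Σν̃|k|² = τ; alone it gives the GP-scale corollary (in class, multiplicativ

History (route lifecycle, newest last):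
- 2026-08-15T13:39:16Z · CLOSED retired — not-a-thesis: assembly does not conclude the sub-problem Statement (operator:999:1257524)

sub-problem: BoseEinsteinCondensation · status: closed(retired) · opened planner-plancard-AtomisticToContinuum-BoseEin-49a0a276-0 2026-08-15T12:10:22Z · rev 1 · ledger route-AtomisticToContinuum-BECLevyCoherence
GENERATED by the gate from the ledger (D-0016/17). Provers cite these decls: `theorem foo : Summit.AtomisticToContinuum.BoseEinsteinCondensation.Theses.BECLevyCoherence.<Decl> := …` in Summits/AtomisticToContinuum/BoseEinsteinCondensation/Theorems/<Name>.lean.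
-/

namespace Summit.AtomisticToContinuum.BoseEinsteinCondensation.Theses.BECLevyCoherence

open scoped BigOperators Topology Manifold Classical MeasureTheory ProbabilityTheory Matrix InnerProductSpace ComplexConjugate ContinuousMap
open Filter Set Function TopologicalSpace MeasureTheory

attribute [summit_statement] _root_.BoseEinsteinCondensation

/-- item stmt-AtomisticToContinuum-7466 · crux · rank 2 · closed · moot by None · by planner
why it might fail: The sign is not automatic: UV zeros of the pair amplitude give negative continuum weights at |k|~π/a (N=2: mass fraction 1e-6 at L/R=10) which grid sampling folds onto infrared classes; an infrared failure needs string-like order (d=1: one negative weight at 2k_F) — unproven absent in a 3D fluid.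
sources: MoraCastin2003, Schoenberg1938, BergChristensenRessel1984, PenroseOnsager1956, ForresterEtAl2003
[crux] (card K1, infrared form) for every repulsive finite-range v there are η > 0 and ρ₀ > 0 such
that for 0 < ρ < ρ₀, for all large N, for every ε > 0 there is δ > 0 with: every δ-near-minimiser Ψ
of the periodic energy on the torus of side L = (N/ρ)^(1/3) has strictly positive translation
coherence G_Ψ(i,·) and, on the grid of m = ⌊L/η⌋ points per side, all discrete Lévy weights ν̃_q =
m⁻³ Σ_j log G_Ψ(i, (L/m)j) cos(2π q·j/m), q ≢ 0 mod m, are ≥ −ε (−log G_Ψ is conditionally negative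
definite on the grid; rank 2: line-defining and cheaply falsifiable). [difficulty: open-problem] -/
@[route_item "route-AtomisticToContinuum-BECLevyCoherence"]
def GridInfDivCoherence : Prop :=
  ∀ v : ℝ → ENNReal, Literature.MathematicalPhysics.QuantumManyBody.BoseGas.IsRepulsiveFiniteRange v → ∃ η : ℝ, 0 < η ∧ ∃ ρ₀ : ℝ, 0 < ρ₀ ∧ ∀ ρ : ℝ, 0 < ρ → ρ < ρ₀ → ∀ᶠ N : ℕ in Filter.atTop, ∀ ε : ℝ, 0 < ε → ∃ δ : ENNReal, 0 < δ ∧ ∀ Ψ : Literature.MathematicalPhysics.QuantumManyBody.BoseGas.PeriodicTrialState N (Literature.MathematicalPhysics.QuantumManyBody.BoseGas.sideLength ρ N), Literature.MathematicalPhysics.QuantumManyBody.BoseGas.periodicEnergy v Ψ ≤ Literature.MathematicalPhysics.QuantumManyBody.BoseGas.periodicGroundStateEnergy v N (Literature.MathematicalPhysics.QuantumManyBody.BoseGas.sideLength ρ N) + δ → ∀ i : Fin N, let L : ℝ := Literature.MathematicalPhysics.QuantumManyBody.BoseGas.sideLength ρ N; let m : ℕ := ⌊L / η⌋₊; let G :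 EuclideanSpace ℝ (Fin 3) → ℝ := fun r => (∫ X in Literature.MathematicalPhysics.QuantumManyBody.BoseGas.cellN N L, conj (Ψ.ψ (Function.update X i (X i + r))) * Ψ.ψ X).re; (∀ r, 0 < G r) ∧ ∀ q : Fin 3 → Fin m, (∃ k, (q k : ℕ) ≠ 0) → -ε ≤ (∑ j : Fin 3 → Fin m, Real.log (G (Literature.MathematicalPhysics.QuantumManyBody.BoseGas.latticeVec (L / m) (fun k => ((j k : ℕ) : ℤ)))) * Real.cos (2 * Real.pi * (∑ k, ((q k : ℕ) : ℝ) * ((j k : ℕ) : ℝ)) / m)) / (m : ℝ) ^ 3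

/-- item stmt-AtomisticToContinuum-7467 · crux · rank 3 · closed · moot by None · by planner
why it might fail: A log-level infrared bound (Lévy weights summable against 1/|k| uniformly in N and in ρ→0): any expansion proof meets BogoliubovPerturbationInfrared at d=3, and beyond one-jump dominance ν_k≈n_k/n₀ nothing non-perturbative controls ν; ρ-uniformity of C is an extra bet.
sources: GavoretNozieres1964, Griffin1993, MoraCastin2003, LiebSeiringerSolovejYngvason2005, Fournais2020
[crux] (card M4, the quantity LOGCLUSTER was designed to bound) for every repulsive finite-range v
and every grid scale η > 0 there are C and ρ₀ > 0 such that for 0 < ρ < ρ₀, for all large N, some δ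
> 0: every δ-near-minimiser satisfies Σ_(q≢0) max(ν̃_q,0)/|k_q| ≤ C with |k_q| = (2π/L)·(centred
norm of q) — the positive part of the grid Lévy measure has an N-uniform (−1)-moment (Bogoliubov
value ≈ √2·a/π, density-independent; C may depend on v and η but not on ρ, N). [difficulty:
open-problem] -/
@[route_item "route-AtomisticToContinuum-BECLevyCoherence"]
def LevyNegativeMoment : Prop :=
  ∀ v : ℝ → ENNReal, Literature.MathematicalPhysics.QuantumManyBody.BoseGas.IsRepulsiveFiniteRange v → ∀ η : ℝ, 0 < η → ∃ C : ℝ, ∃ ρ₀ : ℝ, 0 < ρ₀ ∧ ∀ ρ : ℝ, 0 < ρ → ρ < ρ₀ → ∀ᶠ N : ℕ in Filter.atTop, ∃ δ : ENNReal, 0 < δ ∧ ∀ Ψ : Literature.MathematicalPhysics.QuantumManyBody.BoseGas.PeriodicTrialState N (Literature.MathematicalPhysics.QuantumManyBody.BoseGas.sideLength ρ N), Literature.MathematicalPhysics.QuantumManyBody.BoseGas.periodicEnergy v Ψ ≤ Literature.MathematicalPhysics.QuantumManyBody.BoseGas.periodicGroundStateEnergy v N (Literature.MathematicalPhysics.QuantumManyBody.BoseGas.sideLength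 ρ N) + δ → ∀ i : Fin N, let L : ℝ := Literature.MathematicalPhysics.QuantumManyBody.BoseGas.sideLength ρ N; let m : ℕ := ⌊L / η⌋₊; let G : EuclideanSpace ℝ (Fin 3) → ℝ := fun r => (∫ X in Literature.MathematicalPhysics.QuantumManyBody.BoseGas.cellN N L, conj (Ψ.ψ (Function.update X i (X i + r))) * Ψ.ψ X).re; let ν : (Fin 3 → Fin m) → ℝ := fun q => (∑ j : Fin 3 → Fin m, Real.log (G (Literature.MathematicalPhysics.QuantumManyBody.BoseGas.latticeVec (L / m) (fun k => ((j k : ℕ) : ℤ)))) * Real.cos (2 * Real.pi * (∑ k, ((q k : ℕ) : ℝ) * ((j k : ℕ) : ℝ)) / m)) / (m : ℝ) ^ 3; (∑ q : Fin 3 → Fin m with (∃ k, (q k : ℕ) ≠ 0), max (ν q) 0 / (2 * Real.pi / L * Real.sqrt (∑ k, ((min (q k : ℕ) (m - (q k : ℕ)) : ℕ) : ℝ) ^ 2))) ≤ C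

/-- item stmt-AtomisticToContinuum-0827 · crux · rank 4 · open · by planner
why it might fail: PeriodicBEC(v) is ground-state-only (δ after N): the Dirichlet ground state lies a wall term ≫ δ above E₀^per and interior restrictions are neither periodic nor of sharp N, so the hypothesis may never fire; BEC is boundary-condition sensitive (Robinson1976).
sources: LiebSeiringerSolovejYngvason2005, BoccatoSeiringer2023, Junge2026, Robinson1976, LauwersVerbeureZagrebnov2003
[crux] BoundaryTransferWeak (mode-free boundary-condition transfer, per potential): for each
repulsive finite-range v, PeriodicBEC(v) implies ∃ρ₀>0 ∀ρ∈(0,ρ₀) HasGroundStateBEC v ρ (Dirichlet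
ground state, λ_max(γ) ≥ cN via condensateNumber). Not glue: near-minimiser slacks are O(N/L²) while
Dirichlet/periodic energies differ by a boundary term ≫ N/L², so no energy-comparison proof;
expected route: Neumann bracketing of interior sub-boxes (−Δ_Dir ≥ ⊕−Δ_Neu, v ≥ 0) + a mode-free
criterion (λ_max ≥ tr γ²/N). Only the ENERGY analogue is in print (LiebSeiringerSolovejYngvason2005
Ch. 2 after (2.8)). v ≡ 0: hypothesis and conclusion both true. -/
@[route_item "route-AtomisticToContinuum-BECLevyCoherence"]
def BoundaryTransferWeak : Prop :=
  ∀ v : ℝ → ENNReal, Literature.MathematicalPhysics.QuantumManyBody.BoseGas.IsRepulsiveFiniteRange v → (∃ ρ₀ : ℝ, 0 < ρ₀ ∧ ∀ ρ : ℝ, 0 < ρ → ρ < ρ₀ → ∃ c : ℝ, 0 < c ∧ ∀ᶠ N : ℕ in Filter.atTop, ∃ δ : ENNReal, 0 < δ ∧ ∀ Ψ : Literature.MathematicalPhysics.QuantumManyBody.BoseGas.PeriodicTrialState N (Literature.MathematicalPhysics.QuantumManyBody.BoseGas.sideLength ρ N), Literature.MathematicalPhysics.QuantumManyBody.BoseGas.periodicEnergy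 v Ψ ≤ Literature.MathematicalPhysics.QuantumManyBody.BoseGas.periodicGroundStateEnergy v N (Literature.MathematicalPhysics.QuantumManyBody.BoseGas.sideLength ρ N) + δ → ENNReal.ofReal (c * N) ≤ Literature.MathematicalPhysics.QuantumManyBody.BoseGas.condensateOccupation N (Literature.MathematicalPhysics.QuantumManyBody.BoseGas.sideLength ρ N) Ψ.ψ) → ∃ ρ₀ : ℝ, 0 < ρ₀ ∧ ∀ ρ : ℝ, 0 < ρ → ρ < ρ₀ → Literature.MathematicalPhysics.QuantumManyBody.BoseGas.HasGroundStateBEC v ρ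

/-- item stmt-AtomisticToContinuum-0851 · support · rank 9 · closed · moot by None · by planner
sources: LiebSeiringerSolovejYngvason2005
[support] ScatteringLengthFinite: finite range R₀ ⇒ scatteringLength v ≠ ⊤ (indeed a ≤ R₀+ε: trial φ
∈ C¹, φ = 0 on B_{R₀}, φ = 1 off B_{R₀+ε}, so v·φ² = 0 incl. hard cores since ⊤·0 = 0).
[LiebSeiringerSolovejYngvason2005 App. C, Thm C.1 and Remark; scatteringLength_le] -/
@[route_item "route-AtomisticToContinuum-BECLevyCoherence"]
def ScatteringLengthFinite : Prop :=
  ∀ v : ℝ → ENNReal, Literature.MathematicalPhysics.QuantumManyBody.BoseGas.IsRepulsiveFiniteRange v → Literature.MathematicalPhysics.QuantumManyBody.BoseGas.scatteringLength v ≠ ⊤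

/-- item stmt-AtomisticToContinuum-7468 · support · rank 9 · closed · moot by None · by planner
sources: Fournais2020, LiebSeiringerSolovejYngvason2005
[support] (aliasing / Poincaré on cells, provable now) for L > 0, m ≥ 1, T ≥ 0, any periodic trial
state Ψ with total kinetic energy ≤ T and any particle i: condensateOccupation N L Ψ ≥ N·(grid
average of G_Ψ(i,·) over the m³ nodes (L/m)j) − T(L/m)²/(4π²). Proof: grid average = Σ_(k∈(2πm/L)ℤ³)
g_k with g_k = n_k/N ≥ 0 (Fourier in particle i), g_0 = n₀/N by the definition of
condensateOccupation, and Σ_(|k|≥2πm/L) g_k ≤ (L/2πm)² Σ |k|² g_k = (L/2πm)²·(∫|∇_iΨ|²) = (L/2πm)²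
T/N by Bose symmetry. [difficulty: provable-now] -/
@[route_item "route-AtomisticToContinuum-BECLevyCoherence"]
def GridAverageCondensate : Prop :=
  ∀ (N m : ℕ) (L T : ℝ), 0 < L → 0 < m → 0 ≤ T → ∀ Ψ : Literature.MathematicalPhysics.QuantumManyBody.BoseGas.PeriodicTrialState N L, (∫⁻ X in Literature.MathematicalPhysics.QuantumManyBody.BoseGas.cellN N L, Literature.MathematicalPhysics.QuantumManyBody.BoseGas.kineticDensity Ψ.ψ X) ≤ ENNReal.ofReal T → ∀ i : Fin N, ENNReal.ofReal ((N : ℝ) * (∑ j : Fin 3 → Fin m, (∫ X in Literature.MathematicalPhysics.QuantumManyBody.BoseGas.cellN N L, conj (Ψ.ψ (Function.update X i (X i + Literature.MathematicalPhysics.QuantumManyBody.BoseGas.latticeVec (L / m) (fun k => ((j k : ℕ) : ℤ))))) * Ψ.ψ X).re) / (m : ℝ) ^ 3 - T * (L / m) ^ 2 / (4 * Real.pi ^ 2)) ≤ Literature.MathematicalPhysics.QuantumManyBody.BoseGas.condensateOccupation N L Ψ.ψ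

/-- item stmt-AtomisticToContinuum-7469 · support · rank 9 · closed · moot by None · by planner
sources: BergChristensenRessel1984, LiebSeiringerSolovejYngvason2005, Fournais2020
[support] (glue, card M3–M4; conclusion = BECPeriodicReduction.PeriodicBEC = stmt-0826 body
verbatim, so closing it closes 0826 by a one-line theorem) GridInfDivCoherence → LevyNegativeMoment
→ ScatteringLengthFinite → GridAverageCondensate → constant-mode BEC for near-minimisers on the
torus at all small densities. Proof (finite-dimensional but for two inputs): fix v, take η, ρ₀ from
GridInfDiv and C from LevyNegativeMoment at that η; for N large h := L/m ∈ [η, 2η), τ :=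
(E₀^per+δ)/N ≤ τ* := 8πρa + 1 (LSSY2005_upperBound_periodic_holds + ScatteringLengthFinite); (i) G >
0 on the grid, F := log G∘nodes is real, even on (ℤ/m)³, so F(j) = Σ_q ν̃_q cos(2πq·j/m) and −F(j) =
Σ_(q≠0) ν̃_q(1 − cos) (F(0)=0); (ii) discrete f-sum: Σ_q ν̃_q λ_q = −(2/h²)Σ_a F(e_a) ≤ 2τ since 1 −
G(he_a) ≤ τ_a h²/2 (‖T_rΨ−Ψ‖ ≤ |r|‖∂_rΨ‖) and −log x ≤ 2(1−x) on [1/2,1], where λ_q =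
(2/h²)Σ_a(1−cos(2πq̄_a/m)) ≥ (4/π²)|k_q|²; with ν̃ ≥ −ε and ε := h²/(12m³): Σ ν̃⁺|k_q|² ≤
(π²/4)(2τ*+1); (iii) Hölder(3,3/2): Λ := Σ_(q≠0) ν̃_q ≤ Σ ν̃⁺ ≤ ((π²/4)(2τ*+1))^(1/3) C^(2/3) =: Λ*;
(iv) AM–GM over the m³ grid values: grid average of G ≥ exp(mean F) = e^(−Λ) ≥ e^(−Λ*); (v)
GridAverageCondensate: n₀/N ≥ e^(−Λ*) − τ*(2η)²/(4π -/
@[route_item "route-AtomisticToContinuum-BECLevyCoherence"]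
def LevyMassCondensation : Prop :=
  GridInfDivCoherence → LevyNegativeMoment → ScatteringLengthFinite → GridAverageCondensate → ∀ v : ℝ → ENNReal, Literature.MathematicalPhysics.QuantumManyBody.BoseGas.IsRepulsiveFiniteRange v → ∃ ρ₀ : ℝ, 0 < ρ₀ ∧ ∀ ρ : ℝ, 0 < ρ → ρ < ρ₀ → ∃ c : ℝ, 0 < c ∧ ∀ᶠ N : ℕ in Filter.atTop, ∃ δ : ENNReal, 0 < δ ∧ ∀ Ψ : Literature.MathematicalPhysics.QuantumManyBody.BoseGas.PeriodicTrialState N (Literature.MathematicalPhysics.QuantumManyBody.BoseGas.sideLength ρ N), Literature.MathematicalPhysics.QuantumManyBody.BoseGas.periodicEnergy v Ψ ≤ Literature.MathematicalPhysics.QuantumManyBody.BoseGas.periodicGroundStateEnergy v N (Literature.MathematicalPhysics.QuantumManyBody.BoseGas.sideLength ρ N) + δ → ENNReal.ofReal (c * N) ≤ Literature.MathematicalPhysics.QuantumManyBody.BoseGas.condensateOccupation N (Literature.MathematicalPhysics.QuantumManyBody.BoseGas.sideLength ρ N) Ψ.ψ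

/-- item stmt-AtomisticToContinuum-7470 · support · rank 9 · closed · moot by None · by planner
sources: ForresterEtAl2003, Girardeau1960, Lenard1964, Schoenberg1938
[support] (card T1/P2, the d = 1 delimiter, provable now, no hypotheses) for two impenetrable bosons
on a ring of circumference L > 0 the Girardeau one-body density matrix violates negative type of
−log γ with charges (+,−,+,−) at 0, L/4, L/2, 3L/4: γ₂(0,0)·γ₂(L/2,0) < γ₂(L/4,0)². Closed form
γ₂(x,0) = (2/L)[(1−2r)cos πr + (2/π) sin πr], r = |x|/L (integrate |sin||sin|), so the claim is
(2/π)·1 < 2(1/4+1/π)² ⟺ 16π < (π+4)² ⟺ (π−4)² > 0; numerically 2.5465 < 2.5838 at L = 1. Finish with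
nlinarith [Real.pi_gt_three, Real.pi_lt_four] after the two one-dimensional integrals. [difficulty:
provable-now] -/
@[route_item "route-AtomisticToContinuum-BECLevyCoherence"]
def TonksPairNotInfDiv : Prop :=
  ∀ L : ℝ, 0 < L → Literature.Barriers.AtomisticToContinuum.BoseGas.girardeauDensityMatrix 2 L 0 0 * Literature.Barriers.AtomisticToContinuum.BoseGas.girardeauDensityMatrix 2 L (L / 2) 0 < Literature.Barriers.AtomisticToContinuum.BoseGas.girardeauDensityMatrix 2 L (L / 4) 0 ^ 2

/-- item stmt-AtomisticToContinuum-7471 · assembly · rank 1 · closed · moot by None · by planner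
sources: LiebSeiringerSolovejYngvason2005, PenroseOnsager1956
[assembly] GridInfDivCoherence → LevyNegativeMoment → ScatteringLengthFinite → GridAverageCondensate
→ LevyMassCondensation → BoundaryTransferWeak → BoseEinsteinCondensation. -/
@[route_item "route-AtomisticToContinuum-BECLevyCoherence"]
def Assembly : Prop :=
  GridInfDivCoherence → LevyNegativeMoment → ScatteringLengthFinite → GridAverageCondensate → LevyMassCondensation → BoundaryTransferWeak → Literature.MathematicalPhysics.QuantumManyBody.BoseGas.BoseEinsteinCondensation

end Summit.AtomisticToContinuum.BoseEinsteinCondensation.Theses.BECLevyCoherence
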